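import Literature.AlgebraicGeometry.ComplexMultiplication.EndomorphismFieldSimpleFourfoldDichotomy
import Literature.AlgebraicGeometry.Pohlmann1968.SimpleCMAbelianFourfoldHodgeConjecture
import HarnessLib

/-!
# The Hodge conjecture for all powers of every pair `(A, ι : F →+* End_ℚ(A))` of dimension `≤ 5` —
# unconditionally off the simple fourfolds of Weil type, and on them granted Markman 2025

Topic `Literature/AlgebraicGeometry/ComplexMultiplication` (family `hodge`, lane `lit-hodgefound`; the ALGEBRAIC
carrier `Motives.AbelianVariety ℂ`).  Capstone of the lineage `EndomorphismFieldNondegenerateType` (prime dimension,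
`dim ≤ 3`, non-simple small dimensions: `B = D` on all powers, no simplicity), `EndomorphismFieldSimpleFourfoldDichotomy`
(simple fourfold pairs: `B = D` on all powers iff no Weil subfield iff no Weil-type operator from `F`) and the tree's
`Pohlmann1968/SimpleCMAbelianFourfoldHodgeConjecture` (simple CM fourfolds and all their powers satisfy the Hodge
conjecture GRANTED the tree's named fact `HodgeTheory.Markman2025_weilClasses_algebraic_abelianFourfold`; `dim ≤ 5`).
Here the statements for PAIRS — a CM field `F ⊆ End_ℚ(A)` of degree `2 dim A`, `A` simple OR NOT.

PRINTED STATEMENTS.  B. B. Gordon, *A survey of the Hodge conjecture for abelian varieties* (1999): Thm. 6.3 with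
Corollary and Remark (prime dimension: Tankeev, Ribet), 5.13 (i)–(ii) (CM fourfolds), Thm. 6.4 (Hazama), §10.12.2
(Abdulali: HC for a Weil-type fourfold gives HC for its powers); K. Ribet, *Division fields of abelian varieties with
complex multiplication* (1980) §3 (3.7) (degree `≤ 6`: nondegenerate); B. Moonen, Yu. Zarhin, Duke Math. J. 77 (1995)
Thm. 2.4; E. Markman (2025), the algebraicity of Weil classes on abelian fourfolds of Weil type (the tree's fact
`Markman2025_weilClasses_algebraic_abelianFourfold`, cited there).

WHAT IS PROVED (pair `ιF : F →+* A.endAlgebra`, `hF : [F:ℚ] = 2 dim A`, `F` CM; theorems only, no definition, no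
named fact):
* `isStablyNondegenerate_of_dim_le_five_of_ne_four` — `dim A ∈ {1,2,3,5}`: `B(Aⁿ) = D(Aⁿ)` for all `n`, UNCONDITIONALLY,
  simple or not; `isStablyNondegenerate_of_dim_eq_four_of_not_isSimple`;
* **`isStablyNondegenerate_of_dim_eq_four_of_forall_not_weilSubfield`** — a fourfold pair with NO quadratic subfield of
  `F` with a complex place over which THE type has multiplicities `(2,2)` has `B = D` on all powers (simple: Gordon
  5.13 (i); non-simple: the core has dimension `≤ 2`);
* **`isStablyNondegenerate_or_weilType_of_dim_le_five`** — THE DICHOTOMY: a pair of dimension `≤ 5` has `B = D` on all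
  powers, OR `A` is a SIMPLE FOURFOLD and some `u ∈ End(A)` with `1 ⊗ u ∈ ι(F)` makes `(A, u)` of Weil type `(2, d)`;
  `hodgeConjectureFor_powSucc_of_dim_le_five_of_not_weilType` (the Hodge conjecture for all powers in the first case);
* **`hodgeConjectureFor_powSucc_of_dim_le_five_of_markman`** — GRANTED MARKMAN 2025, the Hodge conjecture for every
  power `A^{N+1}` of EVERY pair of dimension `≤ 5` (no simplicity), and for everything isogenous to such a power
  (`hodgeConjectureFor_of_isIsogenous_powSucc_of_dim_le_five_of_markman`); `hodgeConjectureFor_powSucc_of_dim_eq_four_of_markman`.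

No `sorry`; axioms `propext`, `Classical.choice`, `Quot.sound`.

## References
* [Gordon1999HodgeAVSurvey] B. B. Gordon, *A survey of the Hodge conjecture for abelian varieties* (1999), 5.13, Thm. 6.3,
  Thm. 6.4, §10.12.2.
* [Ribet1980] K. A. Ribet, *Division fields of abelian varieties with complex multiplication* (1980), §3 (3.7).
* [MoonenZarhin1995Duke] B. Moonen, Yu. Zarhin, Duke Math. J. 77 (1995), Thm. 2.4.
* [Markman2025SecantWeil] E. Markman, *The monodromy of generalized Kummer varieties and algebraic cycles …* /
  secant-sheaf construction (2025), Cor. 1.6.1 (as cited by the tree's fact).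
* [vanGeemen1994HodgeAV] B. van Geemen, LNM 1594 (1994), 4.9 and §3.6–3.7 Lemma 3.7.
-/

noncomputable section

open CategoryTheory NumberField Module

namespace Literature.AlgebraicGeometry.ComplexMultiplication

open scoped Manifold Classical nonZeroDivisors
open Literature.AlgebraicGeometry.Motives Literature.AlgebraicGeometry.HodgeTheory
open Literature.AlgebraicGeometry.Pohlmann1968 (IsNondegenerate cmTypeRank cmTypeRank_le isNondegenerate_iff)
open Literature.AlgebraicGeometry.Milne1999 (IsOfCMType)
open Literature.NumberTheory.ComplexMultiplication

namespace EndFieldFullDegree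

variable {F : Type} [Field F] [NumberField F] [IsCMField F] {A : AbelianVariety ℂ}
  (ιF : F →+* A.endAlgebra) (hF : finrank ℚ F = 2 * A.dim)

/-! ### §1 Unconditional cases -/

omit [IsCMField F] in
include ιF hF in
/-- **`dim A ∈ {1, 2, 3, 5}`: `B(Aⁿ) = D(Aⁿ)` for every `n`, unconditionally and without simplicity** (Ribet (3.7) for
`dim ≤ 3`; prime dimension `5`: Tankeev–Ribet / Yanai, Gordon Thm. 6.3 — `EndomorphismFieldNondegenerateType`).
[cite: Ribet1980, §3 Examples (3.7) (p. 87)] [cite: Gordon1999HodgeAVSurvey, Thm. 6.3 with Corollary and Remark] -/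
theorem isStablyNondegenerate_of_dim_le_five_of_ne_four (h5 : A.dim ≤ 5) (h4 : A.dim ≠ 4) :
    IsStablyNondegenerate A := by
  by_cases h3 : A.dim ≤ 3
  · exact isStablyNondegenerate_of_dim_le_three ιF hF h3
  · have h45 : A.dim = 5 := by omega
    exact isStablyNondegenerate_of_prime ιF hF (by rw [h45]; exact Nat.prime_five)

omit [IsCMField F] in
include ιF hF in
/-- **A NON-SIMPLE fourfold pair has `B = D` on all powers** (its simple core has dimension `1` or `2`).
[cite: Gordon1999HodgeAVSurvey, Thm. 6.4 and §9.3] [cite: Ribet1980, §3 Examples (3.7) (p. 87)] -/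
theorem isStablyNondegenerate_of_dim_eq_four_of_not_isSimple (h4 : A.dim = 4) (hns : ¬ AbelianVariety.IsSimple A) :
    IsStablyNondegenerate A :=
  isStablyNondegenerate_of_not_isSimple ιF hF hns fun d hd hlt => by
    rw [h4] at hd hlt
    have : d ≤ 4 := Nat.le_of_dvd (by norm_num) hd
    interval_cases d <;> simp_all

include hF in
/-- **A fourfold pair with no Weil subfield has `B = D` on all powers, unconditionally** — simple: Gordon 5.13 (i)
(`isDivisorGenerated_iff_forall_not_weilSubfield`, `isStablyNondegenerate_iff_isDivisorGenerated` of
`EndomorphismFieldSimpleFourfoldDichotomy`); non-simple: the previous theorem.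
[cite: Gordon1999HodgeAVSurvey, 5.13 (i) and Thm. 6.4] [cite: MoonenZarhin1995Duke, Thm. 2.4] -/
theorem isStablyNondegenerate_of_dim_eq_four_of_forall_not_weilSubfield (h4 : A.dim = 4)
    (hW : ∀ k : IntermediateField ℚ F, finrank ℚ k = 2 → ∀ τ₀ : k →+* ℂ, ComplexEmbedding.conjugate τ₀ ≠ τ₀ →
      ¬ ∀ τ : k →+* ℂ, {φ : F →+* ℂ | φ.comp (algebraMap k F) = τ ∧ φ ∈ (cmTypeOfPair ιF hF).1}.ncard =
        {φ : F →+* ℂ | φ.comp (algebraMap k F) = τ ∧ φ ∉ (cmTypeOfPair ιF hF).1}.ncard) :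
    IsStablyNondegenerate A := by
  by_cases hS : AbelianVariety.IsSimple A
  · exact (isStablyNondegenerate_iff_isDivisorGenerated ιF hF hS h4).2
      ((isDivisorGenerated_iff_forall_not_weilSubfield ιF hF hS h4).2 hW)
  · exact isStablyNondegenerate_of_dim_eq_four_of_not_isSimple ιF hF h4 hS

include hF in
/-- **THE DICHOTOMY FOR PAIRS OF DIMENSION `≤ 5`: either `B(Aⁿ) = D(Aⁿ)` for all `n` (so the Hodge conjecture holds
for every power), or `A` is a SIMPLE FOURFOLD of WEIL TYPE `(2, d)` for an operator `u ∈ End(A)` coming from `F`**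
(Moonen–Zarhin 2.4 in van Geemen's language, `exists_isWeilType_iff_exists_exceptional_two`).
[cite: MoonenZarhin1995Duke, Thm. 2.4 with Corollary] [cite: Gordon1999HodgeAVSurvey, 5.13, Thm. 6.3, Thm. 6.4]
[cite: vanGeemen1994HodgeAV, 4.9] -/
theorem isStablyNondegenerate_or_weilType_of_dim_le_five (h5 : A.dim ≤ 5) :
    IsStablyNondegenerate A ∨ (AbelianVariety.IsSimple A ∧ A.dim = 4 ∧
      ∃ (α : F) (u : End A) (d : ℕ), AbelianVariety.endAlgebra.of A u = ιF α ∧ HodgeTheory.IsWeilType A u 2 d) := by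
  by_cases h4 : A.dim = 4
  · by_cases hS : AbelianVariety.IsSimple A
    · by_cases hD : IsDivisorGenerated A
      · exact Or.inl ((isStablyNondegenerate_iff_isDivisorGenerated ιF hF hS h4).2 hD)
      · right
        refine ⟨hS, h4, (exists_isWeilType_iff_exists_exceptional_two ιF hF hS h4).2 ?_⟩
        rw [isDivisorGenerated_iff_not_exists_exceptional_two ιF hF hS h4, not_not] at hD
        exact hD
    · exact Or.inl (isStablyNondegenerate_of_dim_eq_four_of_not_isSimple ιF hF h4 hS)
  · exact Or.inl (isStablyNondegenerate_of_dim_le_five_of_ne_four ιF hF h5 h4)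

include hF in
/-- **The Hodge conjecture for all powers of a pair of dimension `≤ 5` that is not a simple fourfold of Weil type —
unconditionally.** [cite: Gordon1999HodgeAVSurvey, 5.13 (i), Thm. 6.3, Thm. 6.4] [cite: Ribet1980, §3 Examples (3.7) (p. 87)] -/
theorem hodgeConjectureFor_powSucc_of_dim_le_five_of_not_weilType (h5 : A.dim ≤ 5)
    (hW : ¬ (AbelianVariety.IsSimple A ∧ A.dim = 4 ∧
      ∃ (α : F) (u : End A) (d : ℕ), AbelianVariety.endAlgebra.of A u = ιF α ∧ HodgeTheory.IsWeilType A u 2 d))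
    (N : ℕ) : HodgeConjectureFor (A.powSucc N).dim (A.powSucc N).X :=
  ((isStablyNondegenerate_or_weilType_of_dim_le_five ιF hF h5).resolve_right hW).hodgeConjectureFor_powSucc N

/-! ### §2 Granted Markman 2025: every pair of dimension `≤ 5` -/

omit [IsCMField F] in
include ιF hF in
/-- **Granted Markman's theorem, the Hodge conjecture holds for every power of EVERY fourfold pair** — simple (the
tree's `hodgeConjectureFor_powSucc_of_dim_four_of_markman`, `A` being of CM type by `EndFieldFullDegree.isOfCMType`) or
not (unconditional). [cite: Gordon1999HodgeAVSurvey, 5.13 (i)–(ii) and §10.12.2] [cite: Markman2025SecantWeil, Cor. 1.6.1]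
[cite: MoonenZarhin1995Duke, Thm. 2.4] -/
theorem hodgeConjectureFor_powSucc_of_dim_eq_four_of_markman (hM : Markman2025_weilClasses_algebraic_abelianFourfold)
    (h4 : A.dim = 4) (N : ℕ) : HodgeConjectureFor (A.powSucc N).dim (A.powSucc N).X := by
  by_cases hS : AbelianVariety.IsSimple A
  · exact Pohlmann1968.hodgeConjectureFor_powSucc_of_dim_four_of_markman hM hS h4 (isOfCMType ιF hF) N
  · exact (isStablyNondegenerate_of_dim_eq_four_of_not_isSimple ιF hF h4 hS).hodgeConjectureFor_powSucc N

omit [IsCMField F] in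
include ιF hF in
/-- **GRANTED MARKMAN 2025: the Hodge conjecture for every power `A^{N+1}` of every complex abelian variety of
dimension `≤ 5` carrying a CM field of degree `2 dim A` in `End_ℚ(A)`** — no simplicity (dimensions `≠ 4`
unconditionally; fourfolds by the previous theorem). [cite: Gordon1999HodgeAVSurvey, 5.13, Thm. 6.3, Thm. 6.4, §10.12.2]
[cite: Ribet1980, §3 Examples (3.7) (p. 87)] [cite: Markman2025SecantWeil, Cor. 1.6.1] -/
theorem hodgeConjectureFor_powSucc_of_dim_le_five_of_markman (hM : Markman2025_weilClasses_algebraic_abelianFourfold)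
    (h5 : A.dim ≤ 5) (N : ℕ) : HodgeConjectureFor (A.powSucc N).dim (A.powSucc N).X := by
  by_cases h4 : A.dim = 4
  · exact hodgeConjectureFor_powSucc_of_dim_eq_four_of_markman ιF hF hM h4 N
  · exact (isStablyNondegenerate_of_dim_le_five_of_ne_four ιF hF h5 h4).hodgeConjectureFor_powSucc N

omit [IsCMField F] in
include ιF hF in
/-- … **and for every complex abelian variety isogenous to such a power** (the isotypic components `X ∼ A^{N+1}`).
[cite: Gordon1999HodgeAVSurvey, §10.12.2] [cite: vanGeemen1994HodgeAV, §3.6–3.7 Lemma 3.7] [cite: Markman2025SecantWeil, Cor. 1.6.1] -/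
theorem hodgeConjectureFor_of_isIsogenous_powSucc_of_dim_le_five_of_markman
    (hM : Markman2025_weilClasses_algebraic_abelianFourfold) (h5 : A.dim ≤ 5) {X : AbelianVariety ℂ} {N : ℕ}
    (hX : X.IsIsogenous (A.powSucc N)) : HodgeConjectureFor X.dim X.X :=
  HodgeConjectureFor.of_isIsogenous hX (hodgeConjectureFor_powSucc_of_dim_le_five_of_markman ιF hF hM h5 N)

omit [IsCMField F] in
include ιF hF in
/-- The Hodge conjecture for the pair's variety itself, `dim A ≤ 5`, granted Markman. [cite: Gordon1999HodgeAVSurvey, 5.13 and Thm. 6.3]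
[cite: Markman2025SecantWeil, Cor. 1.6.1] -/
theorem hodgeConjectureFor_of_dim_le_five_of_markman (hM : Markman2025_weilClasses_algebraic_abelianFourfold)
    (h5 : A.dim ≤ 5) : HodgeConjectureFor A.dim A.X :=
  hodgeConjectureFor_powSucc_of_dim_le_five_of_markman ιF hF hM h5 0

end EndFieldFullDegree

end Literature.AlgebraicGeometry.ComplexMultiplication

end
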